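import Mathlib.CategoryTheory.Monoidal.Cartesian.Basic
import HarnessLib

/-!
# Natural isomorphisms of cartesian (product-preserving) monoidal functors are monoidal

Topic `Literature/AlgebraicGeometry/Motives` (pure category theory, Mathlib-only; placed next to its consumers
`Motives/AbelianVarietyBaseChangeTower` — the tower isomorphism `bcFunctorTowerIso k k′ S : bcFunctor k k′ ⋙ bcFunctor k′ S
≅ bcFunctor k S` of base-change functors — and `Liu2021/Lemma24OfJacobianDimension`, piece «F6 helper (iv)» of the
(G)-road of the `hodgecm-mathlib` cell: moving the chart `E_c × E_c ⟶ (∇X)_L ↪ (X × X)_L` of an Albanese datum from `L`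
to `ℂ` along `k → L → ℂ` requires `e_{X ⊗ X}` to match `e_X ⊗ e_X` under the structure maps `μ`).  THEOREMS ONLY (no
definition, no named fact, D-0026 ±0).

For monoidal functors `F : C ⥤ D`, `G : D ⥤ E`, `H : C ⥤ E` between CARTESIAN monoidal categories (Mathlib
`CartesianMonoidalCategory`, `Functor.Monoidal`; e.g. `Over.pullback f` between slice categories of schemes):

* `μ_comp_map_μ_comp_eq_of_naturality` (component form) — isomorphisms `e_X : G F X ≅ H X`, `e_Y`, `e_{X⊗Y}` that are
  natural with respect to the two projections satisfy **`μ_G ≫ G(μ_F) ≫ e_{X ⊗ Y} = (e_X ⊗ e_Y) ≫ μ_H`** (both sides are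
  determined by their projections: Mathlib `μ_fst/μ_snd`, `δ_fst/δ_snd`); `δ`-form
  `map_δ_comp_δ_comp_tensorHom_eq_of_naturality`; the «tensor square of a morphism» shapes
  `map_tensorHom_comp_μ_comp_eq_of_naturality` (`G((g ⊗ g′) ≫ μ_F) ≫ e_{X⊗Y} = δ_G ≫ ((Gg ≫ e_X) ⊗ (Gg′ ≫ e_Y)) ≫ μ_H`)
  and `map_lift_tensorHom_comp_μ_comp_eq_of_naturality` (diagonal source `lift u u′`, the shape of
  `inj_q ≫ αx = lift (𝟙 _) pt ≫ ℓ_q ≫ (α_X)_ℂ` in Liu's Lemma 2.4 (1)).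
* `NatIso.μ_comp_map_μ_comp_hom_app` etc. — the same for a natural isomorphism `e : F ⋙ G ≅ H` (every natural
  isomorphism of product-preserving functors is monoidal).

USAGE NOTE (kernel).  Instantiate these lemmas INSIDE proofs (`have := NatIso.μ_comp_map_μ_comp_hom_app _ _ _
(AbelianVariety.bcFunctorTowerIso k L ℂ) X Y`, or the component form with `baseChangeHomObjIsoOfComp` and
`baseChangeHomObjIsoOfComp_comm`), and spell components as `e.hom.app X`, never `(e.app X).hom`: a hand-RESTATED
specialisation at `bcFunctorTowerIso` forces the kernel to unfold the tower isomorphism (an `eqToIso` of base-change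
functors) inside `Over`-compositions and times out («(kernel) deterministic timeout», farm-tested 2026-08-28), while the
instantiated generic statement is accepted instantly.

## References

* [GortzWedhorn2020] U. Görtz, T. Wedhorn, *Algebraic Geometry I*, 2nd ed. (2020), Prop. 4.16 (transitivity of fibre
  products) and §(4.7) (base change commutes with fibre products: `(X ×_S Y)_{(S′)} = X_{(S′)} ×_{S′} Y_{(S′)}`) — the
  geometric instance; the categorical statement is folklore (cartesian functors, uniqueness of comparison maps).
-/

noncomputable section

open CategoryTheory CategoryTheory.Limits MonoidalCategory CartesianMonoidalCategory

namespace Literature.AlgebraicGeometry.Motives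

universe v₁ v₂ v₃ u₁ u₂ u₃

/-! ## §1 Natural isomorphisms of cartesian functors are monoidal -/

section General

variable {C : Type u₁} [Category.{v₁} C] [CartesianMonoidalCategory C]
  {D : Type u₂} [Category.{v₂} D] [CartesianMonoidalCategory D]
  {E : Type u₃} [Category.{v₃} E] [CartesianMonoidalCategory E]
  (F : C ⥤ D) (G : D ⥤ E) (H : C ⥤ E) [F.Monoidal] [G.Monoidal] [H.Monoidal]

/-- **Component form.**  For monoidal functors `F, G, H` between cartesian monoidal categories, isomorphisms
`e_X : G F X ≅ H X`, `e_Y`, `e_{X ⊗ Y}` natural with respect to the two projections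
(`G F pr₁ ≫ e_X = e_{X⊗Y} ≫ H pr₁`, same for `pr₂`) satisfy `μ_G ≫ G(μ_F) ≫ e_{X⊗Y} = (e_X ⊗ e_Y) ≫ μ_H`: both
sides, followed by the isomorphism `δ_H : H(X ⊗ Y) ≅ H X ⊗ H Y`, have the projections `pr₁ ≫ e_X`, `pr₂ ≫ e_Y`.
[cite: GortzWedhorn2020, §(4.7)] -/
theorem μ_comp_map_μ_comp_eq_of_naturality {X Y : C} (eX : G.obj (F.obj X) ≅ H.obj X)
    (eY : G.obj (F.obj Y) ≅ H.obj Y) (eXY : G.obj (F.obj (X ⊗ Y)) ≅ H.obj (X ⊗ Y))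
    (hfst : G.map (F.map (fst X Y)) ≫ eX.hom = eXY.hom ≫ H.map (fst X Y))
    (hsnd : G.map (F.map (snd X Y)) ≫ eY.hom = eXY.hom ≫ H.map (snd X Y)) :
    Functor.LaxMonoidal.μ G (F.obj X) (F.obj Y) ≫ G.map (Functor.LaxMonoidal.μ F X Y) ≫ eXY.hom =
      (eX.hom ⊗ₘ eY.hom) ≫ Functor.LaxMonoidal.μ H X Y := by
  rw [← cancel_mono (Functor.OplaxMonoidal.δ H X Y), Category.assoc, Category.assoc, Category.assoc,
    Functor.Monoidal.μ_δ, Category.comp_id]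
  ext
  · rw [Category.assoc, Category.assoc, Category.assoc, Functor.OplaxMonoidal.δ_fst, ← hfst,
      ← Functor.map_comp_assoc, Functor.Monoidal.μ_fst, Functor.Monoidal.μ_fst_assoc, tensorHom_fst]
  · rw [Category.assoc, Category.assoc, Category.assoc, Functor.OplaxMonoidal.δ_snd, ← hsnd,
      ← Functor.map_comp_assoc, Functor.Monoidal.μ_snd, Functor.Monoidal.μ_snd_assoc, tensorHom_snd]

/-- **Every natural isomorphism `e : F ⋙ G ≅ H` of monoidal functors between cartesian monoidal categories is
monoidal**: `μ_G ≫ G(μ_F) ≫ e_{X ⊗ Y} = (e_X ⊗ e_Y) ≫ μ_H` (the left-hand side is the tensor structure of the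
composite `F ⋙ G`, Mathlib `Functor.LaxMonoidal.comp`). [cite: GortzWedhorn2020, §(4.7)] -/
theorem NatIso.μ_comp_map_μ_comp_hom_app (e : F ⋙ G ≅ H) (X Y : C) :
    Functor.LaxMonoidal.μ G (F.obj X) (F.obj Y) ≫ G.map (Functor.LaxMonoidal.μ F X Y) ≫ e.hom.app (X ⊗ Y) =
      (e.hom.app X ⊗ₘ e.hom.app Y) ≫ Functor.LaxMonoidal.μ H X Y :=
  μ_comp_map_μ_comp_eq_of_naturality F G H (e.app X) (e.app Y) (e.app (X ⊗ Y))
    (e.hom.naturality (fst X Y)) (e.hom.naturality (snd X Y))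

/-- `δ`-form (components): `G(δ_F) ≫ δ_G ≫ (e_X ⊗ e_Y) = e_{X ⊗ Y} ≫ δ_H`. [cite: GortzWedhorn2020, §(4.7)] -/
theorem map_δ_comp_δ_comp_tensorHom_eq_of_naturality {X Y : C} (eX : G.obj (F.obj X) ≅ H.obj X)
    (eY : G.obj (F.obj Y) ≅ H.obj Y) (eXY : G.obj (F.obj (X ⊗ Y)) ≅ H.obj (X ⊗ Y))
    (hfst : G.map (F.map (fst X Y)) ≫ eX.hom = eXY.hom ≫ H.map (fst X Y))
    (hsnd : G.map (F.map (snd X Y)) ≫ eY.hom = eXY.hom ≫ H.map (snd X Y)) :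
    G.map (Functor.OplaxMonoidal.δ F X Y) ≫ Functor.OplaxMonoidal.δ G (F.obj X) (F.obj Y) ≫
        (eX.hom ⊗ₘ eY.hom) = eXY.hom ≫ Functor.OplaxMonoidal.δ H X Y := by
  rw [← cancel_mono (Functor.LaxMonoidal.μ H X Y), Category.assoc, Category.assoc, Category.assoc,
    Functor.Monoidal.δ_μ, Category.comp_id, ← μ_comp_map_μ_comp_eq_of_naturality F G H eX eY eXY hfst hsnd,
    Functor.Monoidal.δ_μ_assoc, ← G.map_comp_assoc, Functor.Monoidal.δ_μ, G.map_id, Category.id_comp]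

/-- **Tensor squares of morphisms** (components; the shape of a chart equation `ℓ ≫ F(incl) = (g ⊗ g′) ≫ μ_F`
transported along `G` and `e`): `G((g ⊗ g′) ≫ μ_F) ≫ e_{X ⊗ Y} = δ_G ≫ ((G g ≫ e_X) ⊗ (G g′ ≫ e_Y)) ≫ μ_H`.
[cite: GortzWedhorn2020, §(4.7)] -/
theorem map_tensorHom_comp_μ_comp_eq_of_naturality {X Y : C} (eX : G.obj (F.obj X) ≅ H.obj X)
    (eY : G.obj (F.obj Y) ≅ H.obj Y) (eXY : G.obj (F.obj (X ⊗ Y)) ≅ H.obj (X ⊗ Y))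
    (hfst : G.map (F.map (fst X Y)) ≫ eX.hom = eXY.hom ≫ H.map (fst X Y))
    (hsnd : G.map (F.map (snd X Y)) ≫ eY.hom = eXY.hom ≫ H.map (snd X Y)) {Z : D} (g : Z ⟶ F.obj X)
    (g' : Z ⟶ F.obj Y) :
    G.map ((g ⊗ₘ g') ≫ Functor.LaxMonoidal.μ F X Y) ≫ eXY.hom =
      Functor.OplaxMonoidal.δ G Z Z ≫ ((G.map g ≫ eX.hom) ⊗ₘ (G.map g' ≫ eY.hom)) ≫
        Functor.LaxMonoidal.μ H X Y := by
  rw [G.map_comp, Category.assoc, ← MonoidalCategory.tensorHom_comp_tensorHom, Category.assoc,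
    ← μ_comp_map_μ_comp_eq_of_naturality F G H eX eY eXY hfst hsnd, Functor.LaxMonoidal.μ_natural_assoc,
    Functor.Monoidal.δ_μ_assoc]

/-- **Diagonal chart shape** (components): `G(lift u u′ ≫ (g ⊗ g′) ≫ μ_F) ≫ e_{X⊗Y} =
lift (G u ≫ G g ≫ e_X) (G u′ ≫ G g′ ≫ e_Y) ≫ μ_H`. [cite: GortzWedhorn2020, §(4.7)] -/
theorem map_lift_tensorHom_comp_μ_comp_eq_of_naturality {X Y : C} (eX : G.obj (F.obj X) ≅ H.obj X)
    (eY : G.obj (F.obj Y) ≅ H.obj Y) (eXY : G.obj (F.obj (X ⊗ Y)) ≅ H.obj (X ⊗ Y))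
    (hfst : G.map (F.map (fst X Y)) ≫ eX.hom = eXY.hom ≫ H.map (fst X Y))
    (hsnd : G.map (F.map (snd X Y)) ≫ eY.hom = eXY.hom ≫ H.map (snd X Y)) {W Z : D} (u u' : W ⟶ Z)
    (g : Z ⟶ F.obj X) (g' : Z ⟶ F.obj Y) :
    G.map (lift u u' ≫ (g ⊗ₘ g') ≫ Functor.LaxMonoidal.μ F X Y) ≫ eXY.hom =
      lift (G.map u ≫ G.map g ≫ eX.hom) (G.map u' ≫ G.map g' ≫ eY.hom) ≫ Functor.LaxMonoidal.μ H X Y := by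
  rw [G.map_comp, Category.assoc,
    map_tensorHom_comp_μ_comp_eq_of_naturality F G H eX eY eXY hfst hsnd g g',
    Functor.OplaxMonoidal.lift_δ_assoc, lift_map_assoc]

/-- `δ`-form for a natural isomorphism `e : F ⋙ G ≅ H`. [cite: GortzWedhorn2020, §(4.7)] -/
theorem NatIso.map_δ_comp_δ_comp_tensorHom_app (e : F ⋙ G ≅ H) (X Y : C) :
    G.map (Functor.OplaxMonoidal.δ F X Y) ≫ Functor.OplaxMonoidal.δ G (F.obj X) (F.obj Y) ≫
        (e.hom.app X ⊗ₘ e.hom.app Y) = e.hom.app (X ⊗ Y) ≫ Functor.OplaxMonoidal.δ H X Y :=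
  map_δ_comp_δ_comp_tensorHom_eq_of_naturality F G H (e.app X) (e.app Y) (e.app (X ⊗ Y))
    (e.hom.naturality (fst X Y)) (e.hom.naturality (snd X Y))

/-- Tensor-square shape for a natural isomorphism `e : F ⋙ G ≅ H`. [cite: GortzWedhorn2020, §(4.7)] -/
theorem NatIso.map_tensorHom_comp_μ_comp_hom_app (e : F ⋙ G ≅ H) {X Y : C} {Z : D} (g : Z ⟶ F.obj X)
    (g' : Z ⟶ F.obj Y) :
    G.map ((g ⊗ₘ g') ≫ Functor.LaxMonoidal.μ F X Y) ≫ e.hom.app (X ⊗ Y) =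
      Functor.OplaxMonoidal.δ G Z Z ≫ ((G.map g ≫ e.hom.app X) ⊗ₘ (G.map g' ≫ e.hom.app Y)) ≫
        Functor.LaxMonoidal.μ H X Y :=
  map_tensorHom_comp_μ_comp_eq_of_naturality F G H (e.app X) (e.app Y) (e.app (X ⊗ Y))
    (e.hom.naturality (fst X Y)) (e.hom.naturality (snd X Y)) g g'

/-- Diagonal chart shape for a natural isomorphism `e : F ⋙ G ≅ H`. [cite: GortzWedhorn2020, §(4.7)] -/
theorem NatIso.map_lift_tensorHom_comp_μ_comp_hom_app (e : F ⋙ G ≅ H) {X Y : C} {W Z : D} (u u' : W ⟶ Z)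
    (g : Z ⟶ F.obj X) (g' : Z ⟶ F.obj Y) :
    G.map (lift u u' ≫ (g ⊗ₘ g') ≫ Functor.LaxMonoidal.μ F X Y) ≫ e.hom.app (X ⊗ Y) =
      lift (G.map u ≫ G.map g ≫ e.hom.app X) (G.map u' ≫ G.map g' ≫ e.hom.app Y) ≫
        Functor.LaxMonoidal.μ H X Y :=
  map_lift_tensorHom_comp_μ_comp_eq_of_naturality F G H (e.app X) (e.app Y) (e.app (X ⊗ Y))
    (e.hom.naturality (fst X Y)) (e.hom.naturality (snd X Y)) u u' g g'

end General

end Literature.AlgebraicGeometry.Motives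

end
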